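import Literature.Geometry.Riemannian.UpperVolumeBound
import Literature.Geometry.Riemannian.KernelNashEntropyUniversalBound
import HarnessLib

/-!
# The upper volume bound with a universal constant (Bamler 2020a, Thm. 8.1, "the entropy term is a
# good term")

R. Bamler, *Entropy and heat kernel bounds on a Ricci flow background*, arXiv:2008.07093 (2020a),
§8.1, remark after Thm. 8.1: "note that `exp(𝒩_{x,t}(r²)) ≤ 1`, so the pointed Nash entropy term is
a good term". The tree's Thm. 8.1 (`exists_riemVolume_ball_le_exp_pointedNashEntropy`) carries the
factor `exp(𝒩*_s(x,t))`; with the universal bound `𝒩* ≤ (m/2) log(H_m/(2m))`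
(`kernelNashEntropy_le_universal`, in place of the source's `𝒩 ≤ 0`) it becomes the entropy-free
bound

  `Vol_t B_t(x, A √(t−s)) ≤ C(m, Λ) e^{C₂(m,Λ) A²} (t − s)^{m/2}`

(`exists_riemVolume_ball_le_uniform`). Everything is proved; no definitions, no named facts.

## References

* R. H. Bamler, *Entropy and heat kernel bounds on a Ricci flow background*, arXiv:2008.07093
  (2020), §8.1 Thm. 8.1 and the remark following it. [Bamler2020Entropy]
-/

noncomputable section

open Set Filter Function MeasureTheory Measure Module
open scoped Manifold ContDiff Topology ENNReal NNReal

namespace Literature.Geometry.Riemannian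

open Lorentzian Lorentzian.PseudoRiemannianMetric

/-- **Bamler 2020a, Thm. 8.1 with a universal constant**: for `m ≥ 3` and `Λ ≥ 0` there are
`C, C₂ > 0` such that for every Ricci flow on `[a, T]` of a smooth family of Riemannian metrics on a
closed connected manifold modelled on `ℝᵐ`, all `a < s < t < T` with `R ≥ R_min` on `M × [s,t]`,
`−R_min (t−s) ≤ Λ`, every `x` and `A ≥ 1`:
`Vol_t B_t(x, A√(t−s)) ≤ C e^{C₂ A²} (t−s)^{m/2}` — Thm. 8.1 and the universal entropy bound
`exp(𝒩*_s(x,t)) ≤ (H_m/(2m))^{m/2}`. [cite: Bamler2020Entropy, §8.1 Thm. 8.1 and remark] -/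
theorem exists_riemVolume_ball_le_uniform (m : ℕ) (hm : 3 ≤ m) {Λ : ℝ} (hΛ : 0 ≤ Λ) :
    ∃ C C₂ : ℝ, 0 < C ∧ 0 < C₂ ∧ ∀ {M : Type*} [TopologicalSpace M]
      [ChartedSpace (EuclideanSpace ℝ (Fin m)) M]
      [IsManifold 𝓘(ℝ, EuclideanSpace ℝ (Fin m)) ∞ M] [T2Space M] [CompactSpace M]
      [SecondCountableTopology M] [MeasurableSpace M] [BorelSpace M] [ConnectedSpace M] [T3Space M]
      {h : ℝ → PseudoRiemannianMetric 𝓘(ℝ, EuclideanSpace ℝ (Fin m)) ∞ (EuclideanSpace ℝ (Fin m))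
        (TangentSpace 𝓘(ℝ, EuclideanSpace ℝ (Fin m)) : M → Type _)}
      {cov : ℝ → CovariantDerivative 𝓘(ℝ, EuclideanSpace ℝ (Fin m)) (EuclideanSpace ℝ (Fin m))
        (TangentSpace 𝓘(ℝ, EuclideanSpace ℝ (Fin m)) : M → Type _)}
      {a T : ℝ} (hflow : IsRicciFlow h cov (Icc a T)) (hh : IsContMDiffFamilyOn ∞ h univ)
      (hR : ∀ r, (h r).IsRiemannian),
      ∀ {s t : ℝ}, a < s → s < t → t < T → ∀ {Rmin : ℝ},
      (∀ r ∈ Icc s t, ∀ z : M, Rmin ≤ (h r).scalarCurvatureWith (cov r) z) →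
      -Rmin * (t - s) ≤ Λ → ∀ (x : M) {A : ℝ}, 1 ≤ A →
      (h t).riemVolume {y | (h t).edist (hR t) x y < ENNReal.ofReal (A * Real.sqrt (t - s))} ≤
        ENNReal.ofReal (C * Real.exp (C₂ * A ^ 2) * (t - s) ^ ((m : ℝ) / 2)) := by
  obtain ⟨C, C₂, hC, hC₂, H81⟩ := exists_riemVolume_ball_le_exp_pointedNashEntropy m hm hΛ
  set cm : ℝ := (m : ℝ) / 2 * Real.log ((((m : ℝ) - 1) * Real.pi ^ 2 / 2 + 4) / (2 * m)) with hcm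
  refine ⟨C * Real.exp cm, C₂, by positivity, hC₂, ?_⟩
  intro M _ _ _ _ _ _ _ _ _ _ h cov a T hflow hh hR s t has hst htT Rmin hRmin hRΛ x A hA
  have hm0 : 0 < m := by omega
  have h1 := H81 hflow hh hR has hst htT hRmin hRΛ x hA
  have hN := kernelNashEntropy_le_universal hflow hh hR hm0 has hst htT x
  refine h1.trans (ENNReal.ofReal_le_ofReal ?_)
  have hfac : 0 ≤ C * Real.exp (C₂ * A ^ 2) * (t - s) ^ ((m : ℝ) / 2) := by
    have : 0 ≤ (t - s) ^ ((m : ℝ) / 2) := Real.rpow_nonneg (sub_pos.2 hst).le _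
    positivity
  calc C * Real.exp (C₂ * A ^ 2) * (t - s) ^ ((m : ℝ) / 2) *
        Real.exp (pointedNashEntropy h (fun r' v ↦ hflow.heatKernelFn hh hR t x (v, r')) m t s)
      ≤ C * Real.exp (C₂ * A ^ 2) * (t - s) ^ ((m : ℝ) / 2) * Real.exp cm :=
        mul_le_mul_of_nonneg_left (Real.exp_le_exp.2 hN) hfac
    _ = C * Real.exp cm * Real.exp (C₂ * A ^ 2) * (t - s) ^ ((m : ℝ) / 2) := by ring

end Literature.Geometry.Riemannian

end
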